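import Summits.Ventures.PercRepro.C026MixedSlacks

/-!
# The c-edge identity: `f_01 = f_00 − (2 − P(B_0)) · I_A` at every edge at `c` (p6, gen 15)

MINE3-SUPERADD §8 (d): if `e` has `c` as an endpoint, a configuration at which `e` is pivotal for
`A = {a ↔ b}` has `a` at one end of `e` and `b` at the other — so `c` itself sits at a mark, and the
pivotal event lies inside `B_0 = {c ↔ {a, b}}` with `e` closed (`pivEvent_A_subset_lift_B`).  Hence
`P(B_0 ∩ Piv_A) = I_A` and the mixed slack `f_01` is determined by `f_00` (`mixedSlack_false_true_cEdge`):
`f_01 = f_00 − (2 − P(B_0)) · I_A`, so that SA at a `c`-edge reads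
`(2 − P(B_0)) · I_A ≤ f_00 + f_10` (`Mix26_iff_cEdge`) and `I_A ≤ P(B_0 ∩ A_0ᶜ)` (`pivA26_le_of_cEdge`).
-/

namespace PercRepro

open Finset

namespace MultiGraph

variable {V E : Type*} (G : MultiGraph V E) [Fintype E] [DecidableEq E]

omit [Fintype E] in
/-- At an edge at `c`, the pivotal event of `A = {a ↔ b}` lies in `B_0 = {c ↔ {a, b}}` with `e` closed:
opening `e` joins `a` to `b` only if `a` and `b` sit at its two ends, one of which is `c`. -/
theorem pivEvent_A_subset_lift_B {e : E} {c : V} (hc : G.fst e = c ∨ G.snd e = c) (a b : V) :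
    pivEvent e (G.connEvent a b) ⊆ lift e false (G.connEvent c a ∪ G.connEvent c b) := by
  rintro ω ⟨hA1, hA0⟩
  have h1 : Function.update ω e true = Function.update (Function.update ω e false) e true := by
    rw [Function.update_idem]
  simp only [mem_lift, Set.mem_compl_iff, mem_connEvent] at hA1 hA0
  rw [h1, conn_update_true_iff] at hA1
  simp only [mem_lift, Set.mem_union, mem_connEvent]
  rcases hA1 with h | ⟨hax, hyb⟩ | ⟨hay, hxb⟩
  · exact absurd h hA0
  · rcases hc with hc | hc
    · rw [hc] at hax
      exact Or.inl hax.symm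
    · rw [hc] at hyb
      exact Or.inr hyb
  · rcases hc with hc | hc
    · rw [hc] at hxb
      exact Or.inr hxb
    · rw [hc] at hay
      exact Or.inl hay.symm

omit [Fintype E] in
/-- At an edge at `c`, the pivotal event of `A` lies in `B_0 ∩ A_0ᶜ`. -/
theorem pivEvent_A_subset_lift_B_inter {e : E} {c : V} (hc : G.fst e = c ∨ G.snd e = c) (a b : V) :
    pivEvent e (G.connEvent a b) ⊆
      lift e false (G.connEvent c a ∪ G.connEvent c b) ∩ (lift e false (G.connEvent a b))ᶜ :=
  fun _ hω => ⟨G.pivEvent_A_subset_lift_B hc a b hω, hω.2⟩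

/-- `I_A` as `P(A_0ᶜ) − P(A_1ᶜ)` in the lifts. -/
theorem pivA26_eq_prob_lift_compl (p : E → ℝ) (e : E) (a b c : V) :
    G.pivA26 p e a b c =
      prob p ((lift e false (G.connEvent a b))ᶜ) - prob p ((lift e true (G.connEvent a b))ᶜ) := by
  rw [pivA26_eq_rowsAc, G.law3_two_add_three_add_four, G.law3_two_add_three_add_four,
    prob_update_one_eq_prob_lift, prob_update_zero_eq_prob_lift]
  rfl

/-- `f_01 − f_00 = P(B_0) · I_A − 2 · P(B_0 ∩ Piv_A)` at every edge. -/
theorem mixedSlack_false_true_sub (p : E → ℝ) (e : E) (a b c : V) :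
    G.mixedSlack p e false true a b c - G.mixedSlack p e false false a b c =
      prob p (lift e false (G.connEvent c a ∪ G.connEvent c b)) * G.pivA26 p e a b c -
        2 * prob p (lift e false (G.connEvent c a ∪ G.connEvent c b) ∩ pivEvent e (G.connEvent a b)) := by
  have hA := lift_false_subset_lift_true (e := e) (G.isUpperSet_connEvent a b)
  have h0 := prob_inter_compl_of_subset p (S := lift e false (G.connEvent c a ∪ G.connEvent c b)) hA
  rw [G.pivA26_eq_prob_lift_compl]
  unfold mixedSlack pivEvent
  linear_combination (-2) * h0

/-- **The c-edge identity** (MINE3-SUPERADD §8 (d)): at an edge at `c`,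
`f_01 = f_00 − (2 − P(B_0)) · I_A`. -/
theorem mixedSlack_false_true_cEdge (p : E → ℝ) {e : E} {c : V} (hc : G.fst e = c ∨ G.snd e = c)
    (a b : V) :
    G.mixedSlack p e false true a b c =
      G.mixedSlack p e false false a b c -
        (2 - prob p (lift e false (G.connEvent c a ∪ G.connEvent c b))) * G.pivA26 p e a b c := by
  have h := G.mixedSlack_false_true_sub p e a b c
  have hsub : lift e false (G.connEvent c a ∪ G.connEvent c b) ∩ pivEvent e (G.connEvent a b) =
      pivEvent e (G.connEvent a b) :=
    Set.inter_eq_right.2 (G.pivEvent_A_subset_lift_B hc a b)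
  rw [hsub, ← G.pivA26_eq_prob_pivEvent] at h
  linarith

/-- **SA at a c-edge**: `(Mix)_e ↔ (2 − P(B_0)) · I_A ≤ f_00 + f_10`. -/
theorem Mix26_iff_cEdge (p : E → ℝ) {e : E} {c : V} (hc : G.fst e = c ∨ G.snd e = c) (a b : V) :
    G.Mix26 p e a b c ↔
      (2 - prob p (lift e false (G.connEvent c a ∪ G.connEvent c b))) * G.pivA26 p e a b c ≤
        G.mixedSlack p e false false a b c + G.mixedSlack p e true false a b c := by
  rw [G.Mix26_iff_mixed, G.mixedSlack_false_true_cEdge p hc a b]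
  constructor <;> intro h <;> linarith

/-- At an edge at `c`, `I_A ≤ P(B_0 ∩ A_0ᶜ)`: the pivotal event of `A` is a sub-event of
«`c` reaches a mark and `a ↮ b` with `e` closed». -/
theorem pivA26_le_of_cEdge {p : E → ℝ} (hp : IsProb p) {e : E} {c : V}
    (hc : G.fst e = c ∨ G.snd e = c) (a b : V) :
    G.pivA26 p e a b c ≤
      prob p (lift e false (G.connEvent c a ∪ G.connEvent c b) ∩ (lift e false (G.connEvent a b))ᶜ) := by
  rw [G.pivA26_eq_prob_pivEvent]
  exact prob_mono hp (G.pivEvent_A_subset_lift_B_inter hc a b)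

end MultiGraph

end PercRepro
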